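import Mathlib
import Summits.PneNP.PneNP.Theorems.SfmBlProp7

/-!
# Trace budget `Σ_T tr(A_T^{2k}) ≤ 2^m·(Nρ^{2k} + 1)` — line «sfm-bl» (PROOF-SFM-BL §6, input (B))

FRONTIER F-N1c; nothing here bears on P vs NP.

Packaging of `SfmBlProp7.sum_trace_pow_le_explicit` for the §6 assembly: once `t₀` is chosen with
`4N²L^{2k} ≤ L^{10(t₀+1)+2}` (`SfmBlNumerics.four_N_sq_pow_le`: any `t₀` with `N ≤ 2^b`, `2k + 2b ≤ 10(t₀+1)`),
the averaged trace of the remainder is at most `2^m·(Nρ^{2k} + 1)`, `ρ = 100γ_sp(log₂(L/γ_sp)+1)`; i.e. with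
`A₁ := 10(Nρ^{2k}+1)` the hypothesis «`Σ_T tr ≤ 2^m·A₁/10`» of the greedy two-part bound.
-/

namespace Summit.PneNP.PneNP.Theorems.SfmBl

open Matrix Finset BigOperators

variable {α β : Type} [Fintype α] [Fintype β] {m : ℕ}

/-- TRACE BUDGET: `Σ_T tr(A_T^{2k}) ≤ 2^m·(N·ρ^{2k} + 1)` under the `t₀`-condition `4N²L^{2k} ≤ L^{10(t₀+1)+2}`. -/
theorem sum_trace_pow_le_budget [DecidableEq α] [DecidableEq β] (B : Fin m → Matrix α β ℝ)
    (hB : ∀ e i k, 0 ≤ B e i k) (hlegs : ∀ e, ∑ i, ∑ k, B e i k ≤ 3) {L : ℝ} (hL : 2 ≤ L)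
    (hrow : ∀ i, ∑ e, ∑ k, B e i k ≤ L) (hcol : ∀ k, ∑ e, ∑ i, B e i k ≤ L)
    (G : SimpleGraph (α ⊕ β)) [DecidableRel G.Adj]
    (hG : ∀ e i k, B e i k ≠ 0 → G.Adj (Sum.inl i) (Sum.inr k))
    {Ldeg : ℕ} (hdeg : ∀ x, G.degree x ≤ Ldeg) (hLdeg : (Ldeg : ℝ) ≤ L)
    {γ' γsp : ℝ} (hγ' : 0 ≤ γ') (hγ'L : 144 * L * Real.log L ≤ γ' ^ 2) (hγ : γ' ≤ γsp)
    (hγsp : 0 < γsp) (hγspL : γsp ≤ L) (t₀ : ℕ)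
    (hsparse : ∀ (u : α → ℝ) (v : β → ℝ), (∀ i, u i = 0 ∨ u i = 1) → (∀ k, v k = 0 ∨ v k = 1) →
      (G.induce {x | Sum.elim u v x = 1}).Connected → (∑ i, u i) + (∑ k, v k) ≤ t₀ →
      u ⬝ᵥ ((∑ e, B e) *ᵥ v) ≤ γsp * Real.sqrt ((∑ i, u i) * (∑ k, v k)))
    (k : ℕ)
    (ht₀ : 4 * ((Fintype.card α : ℝ) + Fintype.card β) ^ 2 * L ^ (2 * k) ≤ L ^ (10 * (t₀ + 1) + 2)) :
    ∑ T : Fin m → Bool,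
        ((Matrix.fromBlocks (0 : Matrix α α ℝ) (sgnMat B T) (sgnMat B T)ᵀ (0 : Matrix β β ℝ))
          ^ (2 * k)).trace
      ≤ 2 ^ m * ((Fintype.card α + Fintype.card β)
            * (100 * (γsp * (Real.logb 2 (L / γsp) + 1))) ^ (2 * k) + 1) := by
  have hL0 : 0 < L := by linarith
  have h := sum_trace_pow_le_explicit B hB hlegs hL hrow hcol G hG hdeg hLdeg hγ' hγ'L hγ hγsp hγspL t₀
    hsparse k
  have h1 : 4 * ((Fintype.card α : ℝ) + Fintype.card β) ^ 2 * L ^ (2 * k) * (L ^ (10 * (t₀ + 1) + 2))⁻¹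
      ≤ 1 := by
    rw [← div_eq_mul_inv, div_le_one (by positivity)]
    exact ht₀
  have h2 : (0 : ℝ) ≤ 2 ^ m := by positivity
  calc _ ≤ _ := h
    _ ≤ 2 ^ m * ((Fintype.card α + Fintype.card β)
            * (100 * (γsp * (Real.logb 2 (L / γsp) + 1))) ^ (2 * k)) + 2 ^ m * 1 := by
        gcongr
    _ = _ := by ring

/-- MARKOV FORM for the potential: with `A₁ := 10·(Nρ^{2k} + 1)`, `Σ_T tr(A_T^{2k}) ≤ 2^m · A₁ / 10`. -/
theorem sum_trace_pow_le_A₁ [DecidableEq α] [DecidableEq β] (B : Fin m → Matrix α β ℝ)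
    (hB : ∀ e i k, 0 ≤ B e i k) (hlegs : ∀ e, ∑ i, ∑ k, B e i k ≤ 3) {L : ℝ} (hL : 2 ≤ L)
    (hrow : ∀ i, ∑ e, ∑ k, B e i k ≤ L) (hcol : ∀ k, ∑ e, ∑ i, B e i k ≤ L)
    (G : SimpleGraph (α ⊕ β)) [DecidableRel G.Adj]
    (hG : ∀ e i k, B e i k ≠ 0 → G.Adj (Sum.inl i) (Sum.inr k))
    {Ldeg : ℕ} (hdeg : ∀ x, G.degree x ≤ Ldeg) (hLdeg : (Ldeg : ℝ) ≤ L)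
    {γ' γsp : ℝ} (hγ' : 0 ≤ γ') (hγ'L : 144 * L * Real.log L ≤ γ' ^ 2) (hγ : γ' ≤ γsp)
    (hγsp : 0 < γsp) (hγspL : γsp ≤ L) (t₀ : ℕ)
    (hsparse : ∀ (u : α → ℝ) (v : β → ℝ), (∀ i, u i = 0 ∨ u i = 1) → (∀ k, v k = 0 ∨ v k = 1) →
      (G.induce {x | Sum.elim u v x = 1}).Connected → (∑ i, u i) + (∑ k, v k) ≤ t₀ →
      u ⬝ᵥ ((∑ e, B e) *ᵥ v) ≤ γsp * Real.sqrt ((∑ i, u i) * (∑ k, v k)))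
    (k : ℕ)
    (ht₀ : 4 * ((Fintype.card α : ℝ) + Fintype.card β) ^ 2 * L ^ (2 * k) ≤ L ^ (10 * (t₀ + 1) + 2))
    {A₁ : ℝ} (hA₁ : A₁ = 10 * ((Fintype.card α + Fintype.card β)
            * (100 * (γsp * (Real.logb 2 (L / γsp) + 1))) ^ (2 * k) + 1)) :
    ∑ T : Fin m → Bool,
        ((Matrix.fromBlocks (0 : Matrix α α ℝ) (sgnMat B T) (sgnMat B T)ᵀ (0 : Matrix β β ℝ))
          ^ (2 * k)).trace ≤ 2 ^ m * A₁ / 10 := by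
  have h := sum_trace_pow_le_budget B hB hlegs hL hrow hcol G hG hdeg hLdeg hγ' hγ'L hγ hγsp hγspL t₀
    hsparse k ht₀
  rw [hA₁]
  calc _ ≤ _ := h
    _ = _ := by ring

end Summit.PneNP.PneNP.Theorems.SfmBl
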